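import Summits.FinalStateConjecture.FinalStateConjecture.Theorems.ClusterCompletenessAdiabaticMultiKerrILEDTailsCutWeightedGraph
import Literature.Geometry.Lorentzian.KerrDomainOfDependence

/-!
# Route ClusterCompleteness — crux `AdiabaticMultiKerrILED`, line `Sketch`:
# the integrated weighted divergence of a spatial radial field between tilted leaves

Helper file for the crux `stmt-FinalStateConjecture-14310`
(`Summit.FinalStateConjecture.FinalStateConjecture.Theses.ClusterCompleteness.AdiabaticMultiKerrILED`),
line `Sketch`, stub `radialField_weighted_graph_le` (lead c7, wave 7).

Setting (one zone, zero spin, rest frame): the STATIC cut-off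
`Wt = χ(u₂/ε − 1) · χ(2 − ‖x⃗‖²/R²)` (`χ = Real.smoothTransition`, `u₂ = Kerr.horizonFn M 0`,
`r = Kerr.radius 0 = ‖x⃗‖`), the tilted leaves `{x⁰ = t + F(x⃗)}` of a `C²` height `F` with
`‖dF‖ ≤ ½` (conormal `n = Kerr.graphConormal F = (1, −∇F)`), and the purely spatial RADIAL
FIELD `V = (0, h x⃗/‖x⃗‖)` of a function `h` which is `C¹` near every point with `r > 2M`,
non-negative on the horizon layer `2M < ‖x⃗‖ ≤ 2M + M/8` and zero for `‖x⃗‖ ≥ R`.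

* `radialField_weighted_graph_le` — **the registered stub**:
  `∫_{u ∈ (0,s]} ∫ Wt (∑_μ ∂_μ V^μ) ≤ ½ ∫_{leaf 0} Wt |h| + ½ ∫_{leaf s} Wt |h|`, by the
  generic slab inequality `tailsCut_weighted_graph_le` for the static weight with `J = V`,
  `e = 0` and the bulk `b = ∑ ∂V` (continuous at the points with `r > 2M`, where `V ∈ C¹`;
  `Wt V ∈ C¹(ℝ⁴)` since `Wt = 0` on the open neighbourhood `{u₂ < ε}` of `{r ≤ 2M}`).
  Pointwise input at slab points with `r > 2M`: Leibniz
  `∑ ∂(Wt V) = Wt ∑ ∂V + ∑ (∂Wt) V` and the sign `∑ (∂Wt) V ≥ 0` — where `h ≠ 0` one has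
  `‖x⃗‖ < R`, so `Wt` is the horizon factor `χ(u₂/ε − 1)` near the point, whose derivative
  along `V` is `h χ' e^{−x⁰/(2M)}/ε (x⃗/‖x⃗‖ · ∇r)`, `∇r = x⃗/‖x⃗‖`; `χ' ≥ 0`, and either
  `u₂ > 2ε` (`χ' = 0`) or `r − 2M = u₂ e^{x⁰/(2M)} ≤ 2ε e^{(s + |F 0| + 2R)/(2M)} ≤ M/8`
  (slope bound `x⁰ ≤ s + F(x⃗) ≤ s + |F 0| + ‖x⃗‖/2`), where `h ≥ 0`. Fluxes:
  `|−∑ V^μ n_μ| = |h| |x⃗·∇F|/‖x⃗‖ ≤ |h|/2`.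

Dafermos–Rodnianski–Shlapentokh-Rothman arXiv:1402.7034, §2.3.2 (energy identity of a current
between leaves); Dafermos–Rodnianski arXiv:0811.0354, §4.1.1 (radial vector fields). [folklore]
-/

noncomputable section

-- the doubled `FinalStateConjecture.FinalStateConjecture` path component trips dupNamespace
set_option linter.dupNamespace false

open Set Filter Metric MeasureTheory
open scoped BigOperators Topology
open Literature.Geometry.Lorentzian

namespace Summit.FinalStateConjecture.FinalStateConjecture.Theorems

/-! ### Local bricks: the smooth step, zero-spin radius calculus, the slope bound -/

/-- `χ' ≥ 0` (`χ = Real.smoothTransition` is monotone). [folklore] -/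
private theorem radialW_deriv_smoothTransition_nonneg (u : ℝ) :
    0 ≤ deriv Real.smoothTransition u :=
  Real.smoothTransition.monotone.deriv_nonneg

/-- `χ' = 0` on `(1, ∞)`, where `χ ≡ 1`. [folklore] -/
private theorem radialW_deriv_smoothTransition_eq_zero_of_one_lt {u : ℝ} (hu : 1 < u) :
    deriv Real.smoothTransition u = 0 := by
  have h : Real.smoothTransition =ᶠ[𝓝 u] fun _ ↦ (1 : ℝ) := by
    filter_upwards [Ioi_mem_nhds hu] with v hv
    exact Real.smoothTransition.one_of_one_le (le_of_lt hv)
  rw [h.deriv_eq, deriv_const]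

/-- For `a = 0` the spatial gradient of the Kerr–Schild radius is the unit radial vector:
`(∇r)_i = x_{i+1}/‖x⃗‖` (`r = ‖x⃗‖`, `Σ = r²`; both sides vanish on the time axis). [folklore] -/
theorem radialW_radiusGradVec_zero_apply (x : E4) (i : Fin 3) :
    Kerr.radiusGradVec 0 (E4.spatial x) i = x i.succ / E4.spatialNorm x := by
  rw [Kerr.radiusGradVec_apply, Kerr.radius_ofTimeSpace_spatial, Kerr.blSigma_spatial_eq,
    Kerr.radius_zero_left, E4.spatial_apply]
  simp only [ne_eq, OfNat.ofNat_ne_zero, not_false_eq_true, zero_pow, zero_mul, ite_self,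
    add_zero]
  rcases eq_or_ne (E4.spatialNorm x) 0 with hs | hs
  · simp [hs]
  · field_simp
    ring

/-- **A spatial radial field is `C¹` near points off the time axis**: for `h ∈ C¹` near `x` and
`‖x⃗‖ > 0`, each component of `V = (0, h x⃗/‖x⃗‖)` is `C¹` near `x` (`‖x⃗‖ = Kerr.radius 0` is
smooth off the axis). [folklore] -/
theorem radialW_contDiffAt_radialField {h : E4 → ℝ} {x : E4} (hx : 0 < E4.spatialNorm x)
    (hh : ContDiffAt ℝ 1 h x) (μ : Fin 4) :
    ContDiffAt ℝ 1 (fun z : E4 ↦ if μ = 0 then (0 : ℝ) else h z * z μ / E4.spatialNorm z) x := by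
  by_cases hμ : μ = 0
  · simp only [hμ, ↓reduceIte]
    exact contDiffAt_const
  · simp only [hμ, ↓reduceIte]
    have hs : ContDiffAt ℝ 1 (fun z : E4 ↦ E4.spatialNorm z) x := by
      rw [show (fun z : E4 ↦ E4.spatialNorm z) = Kerr.radius 0 from
        funext fun z ↦ (Kerr.radius_zero_left z).symm]
      exact Kerr.contDiffAt_radius (by rwa [Kerr.radius_zero_left])
    exact (hh.mul (Kerr.contDiff_coord μ).contDiffAt).div hs hx.ne'

/-- **Slab points are not too late**: if `‖dF‖ ≤ ½` (`F ∈ C²`) and `x⁰ ≤ s + F(x⃗)`, then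
`x⁰ ≤ s + |F(0)| + ‖x⃗‖/2` (mean value inequality). [folklore] -/
theorem radialW_time_le_of_slab {F : E3 → ℝ} (hF : ContDiff ℝ 2 F)
    (hdF : ∀ y, ‖fderiv ℝ F y‖ ≤ 2⁻¹) {s : ℝ} {x : E4} (h2 : x 0 ≤ s + F (E4.spatial x)) :
    x 0 ≤ s + |F 0| + 2⁻¹ * E4.spatialNorm x := by
  have hlip : |F (E4.spatial x) - F 0| ≤ 2⁻¹ * ‖E4.spatial x - 0‖ := by
    rw [← Real.norm_eq_abs]
    exact convex_univ.norm_image_sub_le_of_norm_fderiv_le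
      (fun z _ ↦ hF.differentiable (by simp) z) (fun z _ ↦ hdF z) (mem_univ 0) (mem_univ _)
  rw [sub_zero] at hlip
  have h3 := (abs_le.mp hlip).2
  have h4 := le_abs_self (F 0)
  unfold E4.spatialNorm
  linarith

/-! ### The registered stub -/

/-- **The integrated weighted divergence of a spatial radial field between tilted leaves** (crux
`stmt-FinalStateConjecture-14310`, line `Sketch`, stub `radialField_weighted_graph_le`). For the
static weight `Wt = χ(u₂/ε − 1) χ(2 − ‖x⃗‖²/R²)` (`u₂ = Kerr.horizonFn M 0`, `M, ε, R > 0`,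
`16 ε e^{(s + |F 0| + 2R)/(2M)} ≤ M`), a `C²` height `F` with `‖dF‖ ≤ ½`, `0 ≤ s`, and the radial
field `V = (0, h x⃗/‖x⃗‖)` of a function `h` that is `C¹` near the points with `r > 2M`,
non-negative on the layer `2M < ‖x⃗‖ ≤ 2M + M/8` and zero for `‖x⃗‖ ≥ R`:
`∫_{u ∈ (0,s]} ∫ Wt (∑_μ ∂_μ V^μ)` over the leaves `{x⁰ = u + F}` is at most `½ ∫ Wt |h|` over
`{x⁰ = F}` plus `½ ∫ Wt |h|` over `{x⁰ = s + F}` (`tailsCut_weighted_graph_le` with `J = V`,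
`e = 0`, `b = ∑ ∂V`; pointwise `Wt ∑ ∂V ≤ ∑ ∂(Wt V)` by Leibniz and the sign
`∑ (∂Wt) V ≥ 0`; `|−∑ V^μ n_μ| ≤ |h|/2` for both fluxes; see the module docstring).
Dafermos–Rodnianski–Shlapentokh-Rothman arXiv:1402.7034, §2.3.2; Dafermos–Rodnianski
arXiv:0811.0354, §4.1.1. [folklore] -/
theorem radialField_weighted_graph_le : ∀ (M ε R : ℝ) (F : E3 → ℝ) (h : E4 → ℝ) (s : ℝ), let Wt : E4 → ℝ := fun y ↦ (Real.smoothTransition (Kerr.horizonFn M 0 y / ε - 1) * Real.smoothTransition (2 - E4.spatialNorm y ^ 2 / R ^ 2)); let V : E4 → Fin 4 → ℝ := fun y μ ↦ if μ = 0 then (0 : ℝ) else h y * y μ / E4.spatialNorm y; 0 < M → 0 < ε → 0 < R → 16 * ε * Real.exp ((s + |F 0| + 2 * R) / (2 * M)) ≤ M → ContDiff ℝ 2 F → (∀ y, ‖fderiv ℝ F y‖ ≤ 2⁻¹) → 0 ≤ s → (∀ x : E4, 2 * M < Kerr.radius 0 x → ContDiffAt ℝ 1 h x) → (∀ x : E4,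 2 * M < E4.spatialNorm x → E4.spatialNorm x ≤ 2 * M + M / 8 → 0 ≤ h x) → (∀ x : E4, R ≤ E4.spatialNorm x → h x = 0) → ∫ u in Set.Ioc 0 s, ∫ y : E3, Wt (E4.ofTimeSpace (u + F y) y) * ∑ μ, fderiv ℝ (fun z ↦ V z μ) (E4.ofTimeSpace (u + F y) y) (E4.basisVector μ) ≤ 2⁻¹ * (∫ y : E3, Wt (E4.ofTimeSpace (0 + F y) y) * |h (E4.ofTimeSpace (0 + F y) y)|) + 2⁻¹ * (∫ y : E3, Wt (E4.ofTimeSpace (s + F y) y) * |h (E4.ofTimeSpace (s + F y) y)|) := by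
  intro M ε R F h s Wt V hM hε hR h16 hF hdF hs hh hlayer hfar
  have hWt : ∀ y, Wt y = Real.smoothTransition (Kerr.horizonFn M 0 y / ε - 1) *
      Real.smoothTransition (2 - E4.spatialNorm y ^ 2 / R ^ 2) := fun _ ↦ rfl
  have hV : ∀ y μ, V y μ = if μ = 0 then (0 : ℝ) else h y * y μ / E4.spatialNorm y :=
    fun _ _ ↦ rfl
  have hWt0 : ∀ y, 0 ≤ Wt y := fun y ↦
    mul_nonneg (Real.smoothTransition.nonneg _) (Real.smoothTransition.nonneg _)
  have hrs : ∀ x : E4, Kerr.radius 0 x = E4.spatialNorm x := Kerr.radius_zero_left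
  have hrp : 0 < Kerr.rPlus M 0 := by rw [Kerr.rPlus_zero_right hM.le]; positivity
  -- the weight is smooth and vanishes near every point with `r ≤ 2M`
  have hWs : ContDiff ℝ 1 Wt :=
    (Kerr.contDiff_horizonFactor (a := 0) (n := 1) hrp hε).mul
      (Real.smoothTransition.contDiff.comp
        (contDiff_const.sub ((Kerr.contDiff_spatialNorm_sq (n := 1)).div_const _)))
  have hWev : ∀ x : E4, Kerr.radius 0 x ≤ 2 * M → ∀ᶠ y in 𝓝 x, Wt y = 0 := by
    intro x hx
    have h0 : Kerr.horizonFn M 0 x < ε := by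
      refine lt_of_le_of_lt ?_ hε
      unfold Kerr.horizonFn
      rw [Kerr.rPlus_zero_right hM.le]
      exact mul_nonpos_iff.mpr (Or.inr ⟨by linarith, (Real.exp_pos _).le⟩)
    filter_upwards [(Kerr.continuous_horizonFn M 0).continuousAt.eventually_lt
      continuousAt_const h0] with y hy
    exact tailsCutWeight_eq_zero_of_horizonFn_lt hε hy
  -- the radial field is `C¹` near every point with `r > 2M`
  have hVreg : ∀ x : E4, 2 * M < Kerr.radius 0 x → ∀ μ, ContDiffAt ℝ 1 (fun z ↦ V z μ) x :=
    fun x hx μ ↦ radialW_contDiffAt_radialField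
      (by rw [← hrs]; exact lt_trans (by positivity) hx) (hh x hx) μ
  -- (1) the weighted field is `C¹` on `ℝ⁴`
  have hJ1 : ∀ μ : Fin 4, ContDiff ℝ 1 (fun y ↦ Wt y * V y μ) := by
    refine fun μ ↦ contDiff_iff_contDiffAt.2 fun x ↦ ?_
    rcases lt_or_ge (2 * M) (Kerr.radius 0 x) with hx | hx
    · exact hWs.contDiffAt.mul (hVreg x hx μ)
    · refine (contDiffAt_const (c := (0 : ℝ))).congr_of_eventuallyEq ?_
      filter_upwards [hWev x hx] with y hy
      rw [hy, zero_mul]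
  -- (2) the divergence of the field is continuous at the points with `r > 2M`
  have hb : ∀ x : E4, 2 * M < Kerr.radius 0 x →
      ContinuousAt (fun x ↦ ∑ μ, fderiv ℝ (fun z ↦ V z μ) x (E4.basisVector μ)) x :=
    fun x hx ↦ tendsto_finsetSum _ fun μ _ ↦
      ((hVreg x hx μ).continuousAt_fderiv one_ne_zero).clm_apply continuousAt_const
  -- (3) the pointwise inequality `Wt ∑ ∂V ≤ ∑ ∂(Wt V)` at the slab points with `r > 2M`
  have hdiv : ∀ x : E4, F (E4.spatial x) ≤ x 0 → x 0 ≤ s + F (E4.spatial x) →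
      2 * M < Kerr.radius 0 x →
      Wt x * (∑ μ, fderiv ℝ (fun z ↦ V z μ) x (E4.basisVector μ)) - 0 ≤
        ∑ μ, fderiv ℝ (fun y ↦ Wt y * V y μ) x (E4.basisVector μ) := by
    intro x _h1 h2 hxr
    have hxpos : 0 < Kerr.radius 0 x := lt_trans (by positivity) hxr
    have hxs : 0 < E4.spatialNorm x := by rwa [← hrs]
    have hWd : DifferentiableAt ℝ Wt x := hWs.differentiable one_ne_zero x
    -- Leibniz
    have hL : ∑ μ, fderiv ℝ (fun y ↦ Wt y * V y μ) x (E4.basisVector μ) =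
        Wt x * ∑ μ, fderiv ℝ (fun z ↦ V z μ) x (E4.basisVector μ) +
          ∑ μ, V x μ * fderiv ℝ Wt x (E4.basisVector μ) := by
      rw [Finset.mul_sum, ← Finset.sum_add_distrib]
      refine Finset.sum_congr rfl fun μ _ ↦ ?_
      rw [fderiv_fun_mul hWd ((hVreg x hxr μ).differentiableAt one_ne_zero)]
      simp only [add_apply, smul_apply, smul_eq_mul]
    -- the sign of `∑ (∂Wt) V`
    have hS : 0 ≤ ∑ μ, V x μ * fderiv ℝ Wt x (E4.basisVector μ) := by
      rcases eq_or_ne (h x) 0 with h0 | h0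
      · have hV0 : ∀ μ, V x μ = 0 := fun μ ↦ by
          rw [hV]
          split_ifs
          · rfl
          · rw [h0, zero_mul, zero_div]
        simp only [hV0, zero_mul, Finset.sum_const_zero, le_refl]
      have hxR : E4.spatialNorm x < R := lt_of_not_ge fun hge ↦ h0 (hfar x hge)
      -- near `x` the static cut-off is `1`, so `Wt` is the horizon factor
      have hev : ∀ᶠ y in 𝓝 x, Wt y = Real.smoothTransition (Kerr.horizonFn M 0 y / ε - 1) := by
        filter_upwards [(isOpen_lt (continuous_norm.comp E4.spatial.continuous)
          continuous_const).mem_nhds hxR] with y hy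
        have hy' : E4.spatialNorm y < R := hy
        have h1 : E4.spatialNorm y ^ 2 / R ^ 2 ≤ 1 := by
          rw [div_le_one (by positivity)]
          exact pow_le_pow_left₀ (E4.spatialNorm_nonneg y) hy'.le 2
        rw [hWt, Real.smoothTransition.one_of_one_le
          (show (1 : ℝ) ≤ 2 - E4.spatialNorm y ^ 2 / R ^ 2 by linarith), mul_one]
      -- the derivative of the horizon factor along `V` is `h χ' e^{−x⁰/(2M)}/ε`
      have hdiff : HasFDerivAt (Kerr.horizonFn M 0) (fderiv ℝ (Kerr.horizonFn M 0) x) x :=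
        ((Kerr.contDiffAt_horizonFn M hxpos (n := 1)).differentiableAt (by simp)).hasFDerivAt
      have haff : HasDerivAt (fun u : ℝ ↦ u / ε - 1) (1 / ε) (Kerr.horizonFn M 0 x) :=
        ((hasDerivAt_id _).div_const ε).sub_const 1
      have hd : HasFDerivAt (fun y ↦ Real.smoothTransition (Kerr.horizonFn M 0 y / ε - 1))
          ((deriv Real.smoothTransition (Kerr.horizonFn M 0 x / ε - 1) * (1 / ε)) •
            fderiv ℝ (Kerr.horizonFn M 0) x) x :=
        (((Real.smoothTransition.contDiffAt (n := 1)).differentiableAt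
          (by simp)).hasDerivAt.comp _ haff).comp_hasFDerivAt x hdiff
      have hdW := hd.congr_of_eventuallyEq hev
      set c : ℝ := deriv Real.smoothTransition (Kerr.horizonFn M 0 x / ε - 1) * (1 / ε) with hc
      set E : ℝ := Real.exp (-((2 * M)⁻¹ * x 0)) with hE
      have e0 : V x 0 = 0 := by rw [hV]; rfl
      have es : ∀ i : Fin 3, V x i.succ * fderiv ℝ Wt x (E4.basisVector i.succ) =
          h x * (c * E) * (x i.succ ^ 2 / E4.spatialNorm x ^ 2) := by
        intro i
        rw [hdW.fderiv, smul_apply, smul_eq_mul, Kerr.fderiv_horizonFn_basisVector_succ hxpos,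
          radialW_radiusGradVec_zero_apply, hV]
        simp only [Fin.succ_ne_zero, ↓reduceIte]
        rw [← hE]
        field_simp
      have hsq : ∑ i : Fin 3, x i.succ ^ 2 / E4.spatialNorm x ^ 2 = 1 := by
        rw [← Finset.sum_div, div_eq_one_iff_eq (by positivity), E4.spatialNorm_sq]
        simp only [Fin.sum_univ_three, Fin.succ_zero_eq_one, Fin.succ_one_eq_two,
          Kerr.fin_succ_two_eq_three]
      have hsum : ∑ μ, V x μ * fderiv ℝ Wt x (E4.basisVector μ) = h x * (c * E) := by
        rw [Fin.sum_univ_succ, e0, zero_mul, zero_add, Finset.sum_congr rfl fun i _ ↦ es i,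
          ← Finset.mul_sum, hsq, mul_one]
      rw [hsum]
      rcases le_or_gt (Kerr.horizonFn M 0 x) (2 * ε) with hle | hgt
      · -- on the horizon layer: `r − 2M = u₂ e^{x⁰/(2M)} ≤ 2ε e^{(s + |F 0| + 2R)/(2M)} ≤ M/8`
        have hrad : Kerr.radius 0 x - 2 * M =
            Kerr.horizonFn M 0 x * Real.exp ((2 * M)⁻¹ * x 0) := by
          rw [Kerr.horizonFn, Kerr.rPlus_zero_right hM.le, mul_assoc, ← Real.exp_add,
            neg_add_cancel, Real.exp_zero, mul_one]
        have ht : x 0 ≤ s + |F 0| + 2 * R := by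
          linarith [radialW_time_le_of_slab hF hdF h2]
        have hexp : Real.exp ((2 * M)⁻¹ * x 0) ≤ Real.exp ((s + |F 0| + 2 * R) / (2 * M)) := by
          rw [Real.exp_le_exp, inv_mul_eq_div]
          gcongr
        have hr8 : Kerr.radius 0 x - 2 * M ≤ M / 8 := by
          rw [hrad]
          calc Kerr.horizonFn M 0 x * Real.exp ((2 * M)⁻¹ * x 0)
              ≤ (2 * ε) * Real.exp ((s + |F 0| + 2 * R) / (2 * M)) :=
                mul_le_mul hle hexp (Real.exp_pos _).le (by positivity)
            _ ≤ M / 8 := by linarith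
        have hhx : 0 ≤ h x := hlayer x (by rwa [← hrs]) (by rw [← hrs]; linarith)
        exact mul_nonneg hhx (mul_nonneg
          (mul_nonneg (radialW_deriv_smoothTransition_nonneg _) (by positivity))
          (Real.exp_pos _).le)
      · -- above the layer the horizon factor is locally constant: `χ' = 0`
        have hc0 : c = 0 := by
          rw [hc, radialW_deriv_smoothTransition_eq_zero_of_one_lt, zero_mul]
          rw [lt_sub_iff_add_lt, lt_div_iff₀ hε]
          linarith
        rw [hc0, zero_mul, mul_zero]
    rw [sub_zero, hL]
    linarith
  -- (4) the generic slab inequality for the static weight (`J = V`, `b = ∑ ∂V`, `e = 0`)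
  have key : ∫ u in Set.Ioc 0 s, ∫ y : E3, Wt (E4.ofTimeSpace (u + F y) y) *
      ∑ μ, fderiv ℝ (fun z ↦ V z μ) (E4.ofTimeSpace (u + F y) y) (E4.basisVector μ) ≤
      (∫ y : E3, Wt (E4.ofTimeSpace (0 + F y) y) *
        (-∑ μ, V (E4.ofTimeSpace (0 + F y) y) μ * Kerr.graphConormal F y μ)) -
      (∫ y : E3, Wt (E4.ofTimeSpace (s + F y) y) *
        (-∑ μ, V (E4.ofTimeSpace (s + F y) y) μ * Kerr.graphConormal F y μ)) +
      ∫ u in Set.Ioc 0 s, ∫ y : E3, (fun _ : E4 ↦ (0 : ℝ)) (E4.ofTimeSpace (u + F y) y) :=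
    tailsCut_weighted_graph_le M ε R F V
      (fun x ↦ ∑ μ, fderiv ℝ (fun z ↦ V z μ) x (E4.basisVector μ)) (fun _ ↦ 0) s hM hε hR hF
      hdF hs hJ1 hb continuous_const (fun _ ↦ le_rfl) (fun _ _ ↦ rfl) hdiv
  -- (5) the two weighted fluxes are bounded by `½ ∫ Wt |h|`
  have hgraph : ∀ t : ℝ, Continuous fun y : E3 ↦ E4.ofTimeSpace (t + F y) y := fun t ↦
    E4.continuous_ofTimeSpace' (continuous_const.add hF.continuous) continuous_id
  have hcont : Continuous fun x : E4 ↦ Wt x * |h x| :=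
    continuous_tailsCutWeight_mul R hM hε fun x hx ↦ (hh x hx).continuousAt.abs
  have hlin : ∀ y : E3, ∑ i : Fin 3, y i * Kerr.partialE3 F y i = fderiv ℝ F y y := by
    intro y
    have hy : ∑ i : Fin 3, y i • EuclideanSpace.single i (1 : ℝ) = y := by
      simpa using (EuclideanSpace.basisFun (Fin 3) ℝ).sum_repr y
    calc ∑ i : Fin 3, y i * Kerr.partialE3 F y i
        = ∑ i : Fin 3, fderiv ℝ F y (y i • EuclideanSpace.single i (1 : ℝ)) :=
          Finset.sum_congr rfl fun i _ ↦ by rw [map_smul, smul_eq_mul, Kerr.partialE3]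
      _ = fderiv ℝ F y y := by rw [← map_sum, hy]
  have hflux : ∀ t : ℝ, |∫ y : E3, Wt (E4.ofTimeSpace (t + F y) y) *
      (-∑ μ, V (E4.ofTimeSpace (t + F y) y) μ * Kerr.graphConormal F y μ)| ≤
      2⁻¹ * ∫ y : E3, Wt (E4.ofTimeSpace (t + F y) y) * |h (E4.ofTimeSpace (t + F y) y)| := by
    intro t
    -- pointwise bound `|Wt (−∑ V n)| = Wt |h| |x⃗·∇F|/‖x⃗‖ ≤ ½ Wt |h|`
    have hpt : ∀ y : E3, |Wt (E4.ofTimeSpace (t + F y) y) *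
        (-∑ μ, V (E4.ofTimeSpace (t + F y) y) μ * Kerr.graphConormal F y μ)| ≤
        2⁻¹ * (Wt (E4.ofTimeSpace (t + F y) y) * |h (E4.ofTimeSpace (t + F y) y)|) := by
      intro y
      set x : E4 := E4.ofTimeSpace (t + F y) y with hx
      have hfl : -∑ μ, V x μ * Kerr.graphConormal F y μ = h x / ‖y‖ * fderiv ℝ F y y := by
        rw [Fin.sum_univ_succ, ← hlin y, Finset.mul_sum, neg_add, ← Finset.sum_neg_distrib]
        simp only [hV, ↓reduceIte, zero_mul, neg_zero, zero_add, Fin.succ_ne_zero,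
          Kerr.graphConormal_succ, hx, E4.ofTimeSpace_apply_succ, E4.spatialNorm_ofTimeSpace]
        exact Finset.sum_congr rfl fun i _ ↦ by ring
      have h1 : |fderiv ℝ F y y| ≤ 2⁻¹ * ‖y‖ := (Real.norm_eq_abs _).symm.trans_le <|
        ((fderiv ℝ F y).le_opNorm y).trans (mul_le_mul_of_nonneg_right (hdF y) (norm_nonneg _))
      have hb1 : |h x / ‖y‖ * fderiv ℝ F y y| ≤ 2⁻¹ * |h x| := by
        rw [abs_mul, abs_div, abs_of_nonneg (norm_nonneg y)]
        calc |h x| / ‖y‖ * |fderiv ℝ F y y| ≤ |h x| / ‖y‖ * (2⁻¹ * ‖y‖) :=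
              mul_le_mul_of_nonneg_left h1 (by positivity)
          _ = 2⁻¹ * |h x| * (‖y‖ / ‖y‖) := by ring
          _ ≤ 2⁻¹ * |h x| * 1 := mul_le_mul_of_nonneg_left (div_self_le_one _) (by positivity)
          _ = 2⁻¹ * |h x| := mul_one _
      rw [hfl, abs_mul, abs_of_nonneg (hWt0 x)]
      calc Wt x * |h x / ‖y‖ * fderiv ℝ F y y| ≤ Wt x * (2⁻¹ * |h x|) :=
            mul_le_mul_of_nonneg_left hb1 (hWt0 x)
        _ = 2⁻¹ * (Wt x * |h x|) := by ring
    -- integrability of the majorant: continuous, supported in `‖y‖ ≤ 2R`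
    have hint : Integrable (fun y : E3 ↦ Wt (E4.ofTimeSpace (t + F y) y) *
        |h (E4.ofTimeSpace (t + F y) y)|) := by
      have hc : Continuous fun y : E3 ↦ Wt (E4.ofTimeSpace (t + F y) y) *
          |h (E4.ofTimeSpace (t + F y) y)| := hcont.comp (hgraph t)
      refine hc.integrable_of_hasCompactSupport
        (HasCompactSupport.intro (isCompact_closedBall (0 : E3) (2 * R)) fun y hy ↦ ?_)
      have hy' : 2 * R < ‖y‖ := by rwa [mem_closedBall_zero_iff, not_le] at hy
      rw [hWt, tailsCutWeight_eq_zero_of_lt_spatialNorm_sq hR ?_, zero_mul]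
      rw [E4.spatialNorm_ofTimeSpace]
      nlinarith
    calc |∫ y : E3, Wt (E4.ofTimeSpace (t + F y) y) *
          (-∑ μ, V (E4.ofTimeSpace (t + F y) y) μ * Kerr.graphConormal F y μ)|
        ≤ ∫ y : E3, |Wt (E4.ofTimeSpace (t + F y) y) *
          (-∑ μ, V (E4.ofTimeSpace (t + F y) y) μ * Kerr.graphConormal F y μ)| :=
          abs_integral_le_integral_abs
      _ ≤ ∫ y : E3, 2⁻¹ * (Wt (E4.ofTimeSpace (t + F y) y) * |h (E4.ofTimeSpace (t + F y) y)|) :=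
          integral_mono_of_nonneg (Eventually.of_forall fun y ↦ abs_nonneg _) (hint.const_mul _)
            (Eventually.of_forall hpt)
      _ = 2⁻¹ * ∫ y : E3, Wt (E4.ofTimeSpace (t + F y) y) * |h (E4.ofTimeSpace (t + F y) y)| :=
          integral_const_mul _ _
  have hz : (∫ u in Set.Ioc 0 s, ∫ y : E3, (fun _ : E4 ↦ (0 : ℝ)) (E4.ofTimeSpace (u + F y) y)) =
      0 := by simp
  linarith [(abs_le.mp (hflux 0)).2, (abs_le.mp (hflux s)).1]

end Summit.FinalStateConjecture.FinalStateConjecture.Theorems
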